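import Summits.NavierStokesRegularity.NavierStokesRegularity.Theses.CloudStretchingBudget
import Summits.NavierStokesRegularity.NavierStokesRegularity.Theorems.AdaptedKernelExists.Negative.ViscosityLoadBearing

/-!
# `AdaptedVorticityFloor` (stmt-NavierStokesRegularity-17840): the `L³`-concentration hypothesis is load-bearing

Negative (support) lemma for the crux `CloudStretchingBudget.AdaptedVorticityFloor` (joint J₁ of
route `CloudStretchingBudget`), from the refuter's birth vetting (crux-attack, 2026-08-17).

The crux quantifies over classical Leray–Hopf solutions `u` on `[0, T)` from a rapidly decaying
datum with the eventual Type-I RATE `√(T - t) ‖u t x‖ ≤ C √ν`, a point `x₀` carrying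
`TypeIConcentration`'s conclusion `∀ᶠ t < T, γ ν³ ≤ ∫_{B(x₀, ρ √(ν (T - t)))} ‖u t‖³`, and an adapted
two-sided-Gaussian backward kernel `G` at `x₀` (`AdaptedKernelExists`' clauses); it concludes a FLOOR
`∃ m > 0, ∀ᶠ t < T, m ≤ (T - t) ∫ ‖curl (u t)‖ G t`.

* `adaptedVorticityFloor_false_without_concentration`: with the concentration hypothesis (and its
  parameters `ρ, γ`) deleted and everything else verbatim (the negated statement is written inline,
  no auxiliary `def`), the statement is FALSE. Witness: the rest
  state `u ≡ 0`, `p ≡ 0` at `ν = T = C = 1` (classical, Leray–Hopf from the zero datum, Type-I rate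
  with constant `0` — the rate hypothesis is an upper bound only and does not force a singularity)
  together with the backward heat kernel at `(T, x₀)`, which IS an adapted Gaussian-comparable kernel
  of the zero drift (Literature `isAdaptedBackwardKernel_backwardHeatKernel_Ico`,
  `isGaussianComparable_backwardHeatKernel`, packaged in the accepted
  `AdaptedKernelExistsNegative.conclusion_zero`); its vorticity vanishes identically, so
  `(T - t) ∫ ‖curl (u t)‖ G t = 0 < m`.

So any proof of the crux must use the concentration hypothesis to obtain non-triviality of the
parabolic zoom (exactly as the planner's mechanism does: it is what survives in the tangent flow);
the Type-I rate, the solution class and the kernel clauses alone are satisfied by the rest state.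
No statement of a `Theses` decl is asserted positively here. [folklore]
-/

noncomputable section

namespace Summit.NavierStokesRegularity.NavierStokesRegularity.Theorems.AdaptedVorticityFloorNegative

open Set Filter Topology MeasureTheory Function
open Literature.Analysis.FluidPDE
open Summit.NavierStokesRegularity.NavierStokesRegularity.Theorems.AdaptedKernelExistsNegative

/-- **LOAD-BEARING (`L³` concentration at `x₀`).** `AdaptedVorticityFloor` with the concentration
hypothesis `∀ (ρ γ : ℝ), 0 < ρ → 0 < γ → (∀ᶠ t in 𝓝[<] T, γ * ν ^ 3 ≤ ∫ x in ball x₀ (ρ * √(ν * (T - t))), ‖u t x‖ ^ 3) →`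
deleted (every other clause verbatim, same binders and order; stated inline) is FALSE: at `C = ν = T = 1` the rest state `u ≡ 0`, `p ≡ 0` satisfies the four
solution hypotheses (`AdaptedKernelExistsNegative.hypotheses_zero`) and the Type-I rate, the backward
heat kernel at `(1, 0)` satisfies the kernel clauses and the two-sided Gaussian bounds
(`AdaptedKernelExistsNegative.conclusion_zero`), and the adapted vorticity mass is identically `0`,
so no floor `m > 0` exists. [folklore] -/
theorem adaptedVorticityFloor_false_without_concentration :
    ¬ (∀ C : ℝ, 0 < C → ∀ (ν T : ℝ), 0 < ν → 0 < T → ∀ (u : ℝ → EuclideanSpace ℝ (Fin 3) → EuclideanSpace ℝ (Fin 3)) (p : ℝ → EuclideanSpace ℝ (Fin 3) → ℝ), Literature.Analysis.FluidPDE.IsClassicalNSSolutionOn (Set.Ico 0 T) ν 0 u p → Literature.Analysis.FluidPDE.IsLerayHopfOn T ν 0 (u 0) u → Literature.Analysis.FluidPDE.HasRapidSpatialDecay (u 0) → (∀ᶠ t in 𝓝[<] T, ∀ x, Real.sqrt (T - t) * ‖u t x‖ ≤ C * Real.sqrt ν) → ∀ (x₀ : EuclideanSpace ℝ (Fin 3))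 (t₀ : ℝ) (G : ℝ → EuclideanSpace ℝ (Fin 3) → ℝ), t₀ ∈ Set.Ico 0 T → (ContDiffOn ℝ 2 (Function.uncurry G) (Set.Ico t₀ T ×ˢ Set.univ) ∧ (∀ t ∈ Set.Ico t₀ T, ∀ x, 0 < G t x) ∧ (∀ t ∈ Set.Ico t₀ T, ∀ x, Literature.Analysis.FluidPDE.timeDerivWithin (Set.Ico t₀ T) G t x + fderiv ℝ (G t) x (u t x) + ν * Laplacian.laplacian (G t) x = 0) ∧ (∀ t ∈ Set.Ico t₀ T, ∫ x, G t x = 1) ∧ (∀ φ : EuclideanSpace ℝ (Fin 3) → ℝ, Continuous φ → (∃ M : ℝ, ∀ x, |φ x| ≤ M) → Filter.Tendsto (fun t => ∫ x, φ x * G t x) (nhdsWithin T (Set.Iio T)) (nhds (φ x₀)))) → (∃ c₁ c₂ C₁ C₂ : ℝ, 0 < c₁ ∧ 0 < c₂ ∧ 0 < C₁ ∧ 0 < C₂ ∧ ∀ t ∈ Set.Ico t₀ T, ∀ x, c₁ * (T - t) ^ (-(3:ℝ) / 2) * Real.exp (-(‖x - x₀‖ ^ 2) / (c₂ * (T - t)))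 ≤ G t x ∧ G t x ≤ C₁ * (T - t) ^ (-(3:ℝ) / 2) * Real.exp (-(‖x - x₀‖ ^ 2) / (C₂ * (T - t)))) → ∃ m : ℝ, 0 < m ∧ ∀ᶠ t in 𝓝[<] T, m ≤ (T - t) * ∫ x, ‖Literature.Analysis.FluidPDE.curl (u t) x‖ * G t x) := by
  intro h
  obtain ⟨hcl, hLH, hdec, -⟩ := hypotheses_zero (1 : ℝ) 1
  obtain ⟨t₀, ht₀, G, hK, hGC⟩ := conclusion_zero (ν := (1 : ℝ)) one_pos (T := 1) one_pos (0 : EuclideanSpace ℝ (Fin 3))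
  have hfive := isAdaptedBackwardKernel_iff.1 hK
  have hcomp := isGaussianComparable_iff_fin_three.1 hGC
  have hrate : ∀ᶠ t in 𝓝[<] (1 : ℝ), ∀ x : EuclideanSpace ℝ (Fin 3),
      Real.sqrt (1 - t) * ‖(0 : ℝ → EuclideanSpace ℝ (Fin 3) → EuclideanSpace ℝ (Fin 3)) t x‖ ≤ 1 * Real.sqrt 1 :=
    Eventually.of_forall fun t x => by simp
  obtain ⟨m, hm, hev⟩ := h 1 one_pos 1 1 one_pos one_pos 0 0 hcl hLH hdec hrate 0 t₀ G ht₀ hfive hcomp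
  have hzero : ∀ t : ℝ, (1 - t) * ∫ x, ‖curl ((0 : ℝ → EuclideanSpace ℝ (Fin 3) → EuclideanSpace ℝ (Fin 3)) t) x‖ * G t x = 0 := by
    intro t
    simp only [Pi.zero_apply, curl_zero, norm_zero, zero_mul, integral_zero, mul_zero]
  obtain ⟨t, ht⟩ := hev.exists
  rw [hzero t] at ht
  exact absurd ht (not_le.2 hm)

end Summit.NavierStokesRegularity.NavierStokesRegularity.Theorems.AdaptedVorticityFloorNegative

end
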